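import Summits.SmoothPoincare4.SmoothPoincare4.Theorems.RootDecompAEDoublesBeyondShadowTwoLedgerRoeSound

/-!
# Grade-four ownership ledger `LocalTableLE4 → GradeFourDichotomy` for KMN encoding graphs, part 6/15: blocks: `LocalTableLE4` yields local certificates; the local table

§6 Letters of traced port words are free letters of the shape (`ports_letters_lt`, so `< rank`), rows at increasing
indices form a sublist (`map_getD_sublist`), the owned exponent-sum matrix of the block calculus is the local matrix
`pmat` (`expSum_eq_expo` + conjugacy invariance), hence `localTable_block`: under `LocalTableLE4` the passing
`localCheck` gives `roeSearch = true` on the owned tuple and `roe_sound` a local certificate; `localTable` dispatches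
over the piece type.

THE FAMILY (14 modules `Theorems/RootDecompAEDoublesBeyondShadowTwoLedger*.lean` + the closing module
`Theorems/RootDecompAEDoublesBeyondShadowTwoStubLedgerFour.lean`, one namespace
`Summit.SmoothPoincare4.SmoothPoincare4.Theorems.RootDecompAEDoublesBeyondShadowTwoStubLedgerFour`, linearly chained
imports, split by topic to respect the 400-line bound on proof files).
-/

open Function
open Literature.Topology.FourManifolds

set_option linter.dupNamespace false

noncomputable section

namespace Summit.SmoothPoincare4.SmoothPoincare4.Theorems.RootDecompAEDoublesBeyondShadowTwoStubLedgerFour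

/-! ## §6 Blocks: the local table hypothesis `LocalTableLE4` yields local certificates -/

namespace Block

/-! ### Letters of traced port words -/

/-- A letter emitted by one tracing step is the free letter of some edge. -/
theorem step_letter (sh : Shape) (deco : List ℕ) (s : ℕ × ℕ × ℕ) (x : ℕ × Bool)
    (h : (step sh deco s).2 = some x) : ∃ e, x.1 = sh.letter.getD e 0 := by
  unfold step at h
  cases hf : findDart sh.edges 0 (s.1, s.2.2) with
  | none => simp [hf] at h
  | some ef =>
    obtain ⟨e, first⟩ := ef
    simp only [hf] at h
    split_ifs at h with ht
    refine ⟨e, ?_⟩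
    rw [Option.some.injEq] at h
    rw [← h]

/-- Every letter of a traced word is the free letter of some edge. -/
theorem traceAux_letters (sh : Shape) (deco : List ℕ) (s0 : ℕ × ℕ × ℕ) :
    ∀ (fuel : ℕ) (s : ℕ × ℕ × ℕ) (sts : List (ℕ × ℕ × ℕ)) (w : List (ℕ × Bool)),
      (∀ g ∈ w, ∃ e, g.1 = sh.letter.getD e 0) →
        ∀ g ∈ (traceAux sh deco s0 fuel s sts w).2, ∃ e, g.1 = sh.letter.getD e 0
  | 0, s, sts, w, hw, g, hg => by
    rw [traceAux] at hg
    exact hw g (by simpa using hg)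
  | fuel + 1, s, sts, w, hw, g, hg => by
    rw [traceAux] at hg
    have hP2 : ∀ x, (step sh deco s).2 = some x → ∃ e, x.1 = sh.letter.getD e 0 :=
      fun x hx => step_letter sh deco s x hx
    generalize hr : step sh deco s = r at hg hP2
    obtain ⟨r1, r2⟩ := r
    -- Case on the emitted letter BEFORE using `hg`, so that the `match` of `traceAux` reduces on a constructor
    -- (restating that `match` here would compile to a different auxiliary matcher than the one of `traceAux`,
    -- declared in another module, and `simpa` could not identify the two).
    cases r2 with
    | none =>
      dsimp only at hg
      split_ifs at hg with hret
      · simp only [List.mem_reverse] at hg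
        exact hw g hg
      · exact traceAux_letters sh deco s0 fuel r1 (s :: sts) _ hw g hg
    | some x =>
      have hw' : ∀ g ∈ x :: w, ∃ e, g.1 = sh.letter.getD e 0 := by
        intro g hg
        simp only [List.mem_cons] at hg
        rcases hg with rfl | hg
        · exact hP2 _ rfl
        · exact hw g hg
      dsimp only at hg
      split_ifs at hg with hret
      · simp only [List.mem_reverse] at hg
        exact hw' g hg
      · exact traceAux_letters sh deco s0 fuel r1 (s :: sts) _ hw' g hg

/-- Every letter of a port word of a decorated block is the free letter of some edge. -/
theorem ports_letters (sh : Shape) (deco : List ℕ) (w : List (ℕ × Bool)) (hw : w ∈ ports sh deco)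
    (g : ℕ × Bool) (hg : g ∈ w) : ∃ e, g.1 = sh.letter.getD e 0 := by
  unfold ports at hw
  rw [List.mem_filterMap] at hw
  obtain ⟨s0, -, hs⟩ := hw
  dsimp only at hs
  split_ifs at hs with hc
  rw [Option.some.injEq] at hs
  subst hs
  unfold trace at hg
  exact traceAux_letters sh deco s0 _ _ _ _ (by simp) g hg

/-- The free letters of the seventeen shapes are `< V + 1`. -/
theorem letter_lt (s : BlockShape) : ∀ x ∈ s.shape.letter, x < s.V + 1 := by
  cases s <;> decide

/-- Any default-extended free letter of a shape is `< V + 1`. -/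
theorem getD_letter_lt (s : BlockShape) (e : ℕ) : s.shape.letter.getD e 0 < s.V + 1 := by
  rw [List.getD_eq_getElem?_getD]
  cases h : s.shape.letter[e]? with
  | none => simp
  | some x => simpa using letter_lt s x (List.mem_of_getElem? h)

/-- The vertex count of the shape data is the shape's `V`. -/
theorem shape_V (s : BlockShape) : s.shape.V = s.V := by
  cases s <;> rfl

/-- LETTER BOUND: every letter of every port word of a decorated block of shape `s` is `< V + 1 = rank`. -/
theorem ports_letters_lt (s : BlockShape) (deco : List ℕ) (w : List (ℕ × Bool)) (hw : w ∈ ports s.shape deco)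
    (g : ℕ × Bool) (hg : g ∈ w) : g.1 < s.V + 1 := by
  obtain ⟨e, he⟩ := ports_letters s.shape deco w hw g hg
  rw [he]; exact getD_letter_lt s e

/-! ### Selecting rows by an increasing index list gives a sublist -/

/-- The rows at a strictly increasing list of valid indices form a sublist. -/
theorem map_getD_sublist {α : Type} (d : α) : ∀ (l : List α) (J : List ℕ), J.Pairwise (· < ·) →
    (∀ j ∈ J, j < l.length) → (J.map fun j => l.getD j d).Sublist l
  | [], [], _, _ => List.Sublist.slnil
  | [], j :: J, _, hJ => absurd (hJ j (by simp)) (by simp)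
  | a :: l, [], _, _ => List.nil_sublist _
  | a :: l, j :: J, hpw, hJ => by
    rw [List.pairwise_cons] at hpw
    obtain ⟨hj, hpw'⟩ := hpw
    have hshift : ∀ K : List ℕ, (∀ k ∈ K, 0 < k) → K.Pairwise (· < ·) → (∀ k ∈ K, k < (a :: l).length) →
        (K.map fun k => (a :: l).getD k d).Sublist l := by
      intro K hpos hKpw hKlt
      have heq : (K.map fun k => (a :: l).getD k d) = (K.map (· - 1)).map fun k => l.getD k d := by
        rw [List.map_map]
        refine List.map_congr_left fun k hk => ?_
        obtain ⟨k', rfl⟩ := Nat.exists_eq_succ_of_ne_zero (hpos k hk).ne'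
        rfl
      rw [heq]
      refine map_getD_sublist d l _ ?_ fun k hk => ?_
      · rw [List.pairwise_map]
        exact hKpw.imp_of_mem fun {x y} hx hy hxy => by have := hpos x hx; omega
      · rw [List.mem_map] at hk
        obtain ⟨k', hk', rfl⟩ := hk
        have h1 := hKlt k' hk'
        have h2 := hpos k' hk'
        simp only [List.length_cons] at h1
        omega
    by_cases hj0 : j = 0
    · subst hj0
      rw [List.map_cons]
      exact (hshift J (fun k hk => hj k hk) hpw' fun k hk => hJ k (by simp [hk])).cons_cons _
    · exact (hshift (j :: J) (fun k hk => by
          simp only [List.mem_cons] at hk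
          rcases hk with rfl | hk
          · omega
          · have := hj k hk; omega) (List.pairwise_cons.mpr ⟨hj, hpw'⟩) hJ).cons a

/-! ### Evaluation of the initial substitution -/

/-- A substitution fixing the letters of a word fixes the word. -/
theorem lift_toFG5_eq_self (Λ : Fin 5 → FreeGroup (Fin 5)) (w : List (ℕ × Bool))
    (h : ∀ g ∈ w, Λ (f5 g.1) = FreeGroup.of (f5 g.1)) : FreeGroup.lift Λ (toFG5 w) = toFG5 w := by
  induction w with
  | nil => simp
  | cons g w ih =>
    rw [toFG5_cons, map_mul, ih fun g' hg' => h g' (by simp [hg'])]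
    congr 1
    rw [toFG5_single]
    have hg := h g (by simp)
    split_ifs <;> simp [hg]

end Block

section BlockTable

open Block

/-- The port words of a block piece, as traced letter lists. -/
theorem block_ports (s : BlockShape) (code : ℕ) :
    (Piece.block s code).ports = (ports s.shape (decode (2 * s.V) (code % s.numDeco))).map toFG5 := rfl

/-- A port word of a block piece is `toFG5` of the traced word. -/
theorem block_portWord (s : BlockShape) (code : ℕ) (j : ℕ)
    (hj : j < (ports s.shape (decode (2 * s.V) (code % s.numDeco))).length) :
    (Piece.block s code).portWord j = toFG5 ((ports s.shape (decode (2 * s.V) (code % s.numDeco))).getD j []) := by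
  unfold Piece.portWord
  rw [block_ports, List.getD_eq_getElem _ _ (by simpa using hj), List.getD_eq_getElem _ _ hj, List.getElem_map]

/-- **BLOCKS.**  Under the local table hypothesis, every unimodular owned tuple of a decorated block admits a local
certificate: the block calculus' `localCheck` found an ROE certificate, and `roe_sound` turns it into a passing
local check. -/
theorem localTable_block (hLT : LocalTableLE4) (s : BlockShape) (code : ℕ) {J : List ℕ}
    (h : TableHyp (Piece.block s code) J) : LocalCert (Piece.block s code) J := by
  obtain ⟨hlen, hpw, hports, hmin⟩ := h
  set p := Piece.block s code with hp
  set deco := decode (2 * s.V) (code % s.numDeco) with hdeco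
  set PW := ports s.shape deco with hPW
  have hrank : p.rank = s.V + 1 := rfl
  have hr5 : s.V + 1 ≤ 5 := rank_le_five (Piece.block s code)
  have hnum : p.numPorts = PW.length := by
    simp only [hp, Piece.numPorts, block_ports, List.length_map, hPW, hdeco]
  have hJlt : ∀ j ∈ J, j < PW.length := fun j hj => hnum ▸ hports j hj
  have hLC : localCheck s.shape deco = true :=
    hLT s (code % s.numDeco) (Nat.mod_lt _ (by unfold BlockShape.numDeco; positivity))
  -- letters of the port words
  have hlt : ∀ j, j < PW.length → ∀ g ∈ PW.getD j [], g.1 < s.V + 1 := fun j hj g hg =>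
    ports_letters_lt s deco _ (by rw [List.getD_eq_getElem _ _ hj]; exact List.getElem_mem hj) g hg
  -- the owned tuple of cyclically reduced port words
  set tup := J.map fun j => cycReduce (PW.getD j []) with htup
  have hsub : tup.Sublist (PW.map cycReduce) := by
    have := map_getD_sublist ([] : List (ℕ × Bool)) (PW.map cycReduce) J hpw (by simpa using hJlt)
    have heq : (J.map fun j => (PW.map cycReduce).getD j []) = tup := by
      rw [htup]
      refine List.map_congr_left fun j hj => ?_
      have hjl := hJlt j hj
      rw [List.getD_eq_getElem _ _ (by simpa using hjl), List.getD_eq_getElem _ _ hjl, List.getElem_map]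
    rwa [heq] at this
  have htupmem : tup ∈ (PW.map cycReduce).sublists.filter fun t => t.length = s.V + 1 := by
    rw [List.mem_filter, List.mem_sublists]
    exact ⟨hsub, by simp [htup, hlen, hrank]⟩
  unfold localCheck at hLC
  rw [List.all_eq_true, shape_V] at hLC
  have hc := hLC tup htupmem
  -- the exponent-sum matrix of the tuple is the owned minor's matrix
  have hmat : expMatrix tup (s.V + 1) = pmat p J := by
    unfold expMatrix pmat
    rw [hlen, hrank, htup, List.map_map]
    refine List.map_congr_left fun j hj => ?_
    have hjl := hJlt j hj
    simp only [Function.comp]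
    refine List.map_congr_left fun b hb => ?_
    rw [List.mem_range] at hb
    have hb5 : b < 5 := by omega
    have hsm : Small (cycReduce (PW.getD j [])) := fun g hg => by
      have := hlt j hjl g (mem_cycReduce hg); omega
    rw [expSum_eq_expo _ _ hsm hb5]
    obtain ⟨c, hc'⟩ := isConj_iff.mp (isConj_toFG5_cycReduce (PW.getD j []))
    rw [← expo_conj (f5 b) c, hc', pexpN, dif_pos hb5, pexp, block_portWord s code j hjl]
    congr 1
    exact Fin.ext (Nat.mod_eq_of_lt hb5)
  have hdet1 : (det (expMatrix tup (s.V + 1))).natAbs = 1 := by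
    rw [hmat]
    change (minor p J).natAbs = 1
    rcases hmin with h | h <;> simp [h]
  have hroe : roeSearch (s.V + 1 + 1) tup (List.range (s.V + 1)) = true := by
    rw [Bool.or_eq_true] at hc
    rcases hc with hc | hc
    · rw [hdet1] at hc; simp at hc
    · exact hc
  -- run the soundness of `roeSearch` from the initial local state
  obtain ⟨steps, hst, hperm⟩ := roe_sound p (s.V + 1 + 1) tup (List.range (s.V + 1)) J (linit p) (lunused p) hroe
    (by simp [htup])
    (by
      intro i q j hq hj
      rw [htup, List.getElem?_map, hj, Option.map_some] at hq
      rw [Option.some.injEq] at hq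
      subst hq
      have hjl : j < PW.length := hJlt j (List.mem_of_getElem? hj)
      refine (isConj_toFG5_cycReduce _).trans ?_
      rw [block_portWord s code j hjl, lift_toFG5_eq_self]
      intro g hg
      have hg' := hlt j hjl g hg
      simp only [linit, hrank, f5_val (show g.1 < 5 by omega)]
      rw [if_neg (by omega)])
    (by
      intro q hq g hg
      rw [htup, List.mem_map] at hq
      obtain ⟨j, hj, rfl⟩ := hq
      rw [List.mem_range]
      exact hlt j (hJlt j hj) g (mem_cycReduce hg))
    (fun x hx => by rw [List.mem_range] at hx; omega)
    List.nodup_range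
    (by
      intro x hx
      rw [List.mem_range] at hx
      have hx5 : x < 5 := by omega
      refine ⟨?_, ?_⟩
      · simp only [lunused, List.mem_filter, List.mem_finRange, true_and, decide_eq_true_eq, f5_val hx5, hrank]
        omega
      · simp only [linit, f5_val hx5, hrank]
        rw [if_neg (by omega)])
    (by
      intro y hy
      rw [List.mem_range, not_lt] at hy
      simp only [lunused, List.mem_filter, List.mem_finRange, true_and, decide_eq_true_eq, hrank]
      exact hy)
    (by
      intro y
      simp only [linit, hrank]
      split_ifs with hy
      · exact Subgroup.one_mem _
      · refine Subgroup.subset_closure ⟨y, ?_, ?_⟩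
        · simp only [Set.mem_setOf_eq, List.mem_range]; omega
        · simp only
          congr 1
          exact Fin.ext (Nat.mod_eq_of_lt y.isLt))
  exact ⟨steps, hst, hperm⟩

/-- **THE LOCAL TABLE** at grade `≤ 4`: the six vertex-free pieces by finite check, blocks by `LocalTableLE4`. -/
theorem localTable (hLT : LocalTableLE4) (p : Piece) {J : List ℕ} (h : TableHyp p J) : LocalCert p J := by
  cases p with
  | block s code => exact localTable_block hLT s code h
  | _ => exact localTable_small _ rfl h

end BlockTable

end Summit.SmoothPoincare4.SmoothPoincare4.Theorems.RootDecompAEDoublesBeyondShadowTwoStubLedgerFour
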